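import Summits.QuantumFields.BalabanUV.Beta.GAN24.AliasTiling
import Literature.MathematicalPhysics.QuantumFieldTheory.Balaban1983to89.Beta.FibreInverseDecay

/-!
# `BalabanUV.Beta.GAN24.AliasDecimate` — binder row G-an2-4 / (CONV-C), S-slot road «S3-fibre²», register engine «ALIAS-DECIMATE*» part 2/2:
# DECIMATION = ALIASING for pv17's lattice kernels — `latticeKernel G (L•z + r) = latticeKernel (aliasSym L r G) z`,
# `aliasSym L r G (P) = L^{−(d+1)} Σ_{l ∈ {0,…,L−1}^{d+1}} e^{i k_l(P)·r} G(k_l(P))`, `k_l(P) = (P + 2πl)/L`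

NOT IN PRINT; OUR PROOF ATTEMPT (of the road; THIS file is [folklore] Fourier analysis on `ℤ^{d+1}`: the phase `e^{i k_l(p)·(L•z)} = e^{ip·z}`
on top of part 1 `GAN24/AliasTiling`; no estimate, no cited fact, no `def … : Prop`, no wall binder, no object of an2's typed `U = 1` system).
G-an2-4 formalisation swarm, leaf prover 17 (unit `b2b-balaban-gan24-formalise-leaf-17`, gen 11), register tag «ALIAS-DECIMATE*» (cell journal
INTENT l.4515, RESULT l.4568; FILED under this name on the row owner's ruling, gan24-p1-g4 RULINGS-6 l.4599; typer `GAN24/Formal/LEAVES.md` § II.D, T-E1 class).  HONEST FRAMING (cell contract, verbatim): «discharging `BetaPertH`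
makes Bałaban's UV stability UNCONDITIONAL — a real constructive-QFT result; it is NOT the continuum limit and NOT the Clay problem.»  HONEST
DEPENDENCY (verbatim): «continuum YM on T⁴ ⇐ BetaPertH ∧ nine spine estimates (0/9 proved); BetaPertH ⇐ (D1) ∧ (D4) ∧ CAP+tail; G-an2-4 gates
asym, D1 and NE2/3/4.»  NOT summit progress; nothing of (CONV-C)'s S-slot («E3Shape» ∕ «E3SupRate», OPEN, not in print) is discharged here.

WHERE IT SITS (context only, asserted nowhere below).  Every kernel of road P1 ∕ S3 is a lattice kernel over a COARSE momentum
(`CombesThomasFibre.KInv_eq_re_latticeKernel`: `KInv N x y a b = Re latticeKernel (fibInv N …) (quo N x − quo N y)`), while an1∕an3's finite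
stencils and an2's pushes are written on the FINE lattice.  Passing from a kernel with symbol `G` over the fine momentum to its readings on
the coarser lattice `L•ℤ^{d+1} + r` — one more blocking by `L`, intra-block offset `r` — is the identity of this file; its symbol side is the
alias average over the `L^{d+1}` fine momenta `k_l(P) = (P + 2πl)/L` above the coarse momentum `P` (road P1's T00 `AliasObjects.kAl L P ·` up to
`Fin L ↔ ZMod L`, the dictionary of the records engine E8 `AliasNest`, under which successive blockings compose: `kAl_nest`).  Consumers named
by the typer's prospective cut (`DAG.md` § II.6): R6-symbol (the symbol of ONE `pushSum` — a pushed multiplier leg is a straight-contour block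
sum `Σ_{r ∈ box, s<L} K(M•(L•z + r + s e_μ))`, `PushSumNest.pushSum_inr_inl_coarse`, i.e. `latticeKernel_sum_decimate` below with the contour
weights), R7-symbol (`V3Sym_succ`), R5 (plane-wave symbols of `GAN24/AveragingContourSymbols` read at `M•y + j`), R2b (field-leg re-framing),
R8 (the `Σ_l` is where `GAN24/AliasPointSum` acts).  None of them is touched here.

## What is proved ([folklore], `0 sorry`; lattice `ℤ^{d+1}`, generic `d`, `L ≥ 1`; hypotheses on `G`: GLOBAL coordinatewise `2π`-periodicity
## `hper : ∀ i P, G (update P i (P i + 2π)) = G P` (as in E1 ∕ LK-CONV; automatic for trigonometric polynomials and their inverses,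
## `FibreInverseDecay.cphase_periodic`) and continuity on the real zone `hcont : Continuous (G ∘ ofRealVec)` (§8: automatic for strip-regular `G`))
* §6 `aliasPt L l P = (P + 2πl)/L`, `aliasPt_ofRealVec`; **`aliasSym L r G`**; `phase_update`, `integrand_periodic`, `continuous_integrand`,
  `cexp_phase_apt` (THE phase identity `e^{i k_l(p)·(L•z + r)} = e^{ip·z} e^{i k_l(p)·r}`), `integrand_aliasSym` (pointwise alias average),
  `continuous_aliasSym_ofRealVec`, **`fourierBox_decimate`**, **`latticeKernel_decimate : latticeKernel G (L•z + r) = latticeKernel (aliasSym L r G) z`**,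
  `latticeKernel_zsmul` (`r = 0`), `aliasSym_zero_apply` (plain alias average `L^{−(d+1)} Σ_l G(k_l P)`).
* §7 `aliasSym_periodic`: the aliased symbol is again globally `2π`-periodic in each coordinate (shift `P_i ↦ P_i + 2π` = cyclic shift
  `l_i ↦ l_i + 1` of the alias index, the wrap-around `l_i = L−1 ↦ 0` costing one period of `G` and of the plane wave) — so blockings ITERATE.
* §8 FROM STRIP REGULARITY: `periodic_ofRealVec`, `descend_coe_of_periodic`, `continuous_ofRealVec_of_stripRegular` (a periodic
  `StripRegular G κ M`, `κ ≥ 0`, is continuous at every real momentum — pv17's `B4TorusKernel.continuous_descend` read back; leaf-07-g9's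
  records lemma, re-proved), **`latticeKernel_decimate_of_stripRegular`**.
* §9 OFFSET SUMS: **`latticeKernel_sum_decimate`** — `Σ_{r ∈ R} w_r · latticeKernel G (L•z + r) = latticeKernel (Σ_{r ∈ R} w_r · aliasSym L r G) z`
  (box ∕ straight-contour sums of a fine kernel over an `L`-block = ONE coarse kernel whose symbol carries the contour weight
  `Σ_r w_r e^{i k_l·r}` inside the alias average — the shape of road P1's `FibreSymbols.contourSum_plane` ∕ T00 `sAl`).
WHAT IS NOT HERE: strip regularity of `aliasSym L r G` on the `L`-times-wider coarse strip — NOT derivable from `StripRegular G κ M` +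
periodicity alone (for even `L` the alias `l_i = L/2` folds the period seam `Re k_i = π` into the INTERIOR of the coarse zone, where
`StripRegular` gives no holomorphy); it holds for symbols regular on the FULL periodic strip (trigonometric polynomials, inverse fibre
entries) and is stated when a consumer asks; the `latticeKernel₂` two-leg corollary (the SAME theorem at dimension `(d+1)+(d+1)`, since
`pair (L•z + r) (L•z′ + r′) = L • pair z z′ + pair r r′`); the `pushSum` instance over an2's objects (R6-symbol proper); anything located.
-/

noncomputable section

open Complex Set MeasureTheory
open scoped Real BigOperators
open Literature.MathematicalPhysics.QuantumFieldTheory.Balaban1983to89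
open B4Strip (ofRealVec Strip)
open B4ContourShift (BZ phase integrand fourierBox latticeKernel StripRegular continuous_ofRealVec ofRealVec_mem_Strip)
open B4TorusKernel (rep rep_mem descend continuous_descend)
open Beta.FibreInverseDecay (cphase cphase_periodic isCompact_BZ)
open Summit.QuantumFields.BalabanUV.Beta.GAN24.AliasTiling (periodic_update_int periodic_add_intVec rep_coe_eq_add_int apt
  setIntegral_BZ_eq_sum_alias)

namespace Summit.QuantumFields.BalabanUV.Beta.GAN24.AliasDecimate

variable {d : ℕ}

/-! ## §6 The aliased symbol and THE DECIMATION IDENTITY for `latticeKernel` -/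

section Symbol

variable (L : ℕ)

/-- [folklore] THE (complex) ALIAS MOMENTA over the coarse momentum `P`: `k_l(P)_i = (P_i + 2π l_i)/L`, `l ∈ {0,…,L−1}^{d+1}` — the
`L^{d+1}` fine momenta that fold onto `P` under one blocking by `L` (road P1's T00 `AliasObjects.kAl L P ·` up to `Fin L ↔ ZMod L`). -/
def aliasPt (L : ℕ) (l : Fin (d + 1) → Fin L) (P : Fin (d + 1) → ℂ) : Fin (d + 1) → ℂ :=
  fun i => (P i + 2 * π * ((l i : ℕ) : ℂ)) / L

/-- [folklore] On real momenta the alias momenta are real: `aliasPt L l (ofRealVec p) = ofRealVec ((p + 2πl)/L)`. -/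
theorem aliasPt_ofRealVec (l : Fin (d + 1) → Fin L) (p : Fin (d + 1) → ℝ) :
    aliasPt L l (ofRealVec p) = ofRealVec (apt L l p) := by
  funext i; simp only [aliasPt, apt, ofRealVec]; push_cast; ring

/-- [folklore] **THE ALIASED SYMBOL** of `G` for the blocking factor `L` and the intra-block offset `r ∈ ℤ^{d+1}`:
`aliasSym L r G (P) = L^{−(d+1)} Σ_{l ∈ {0,…,L−1}^{d+1}} e^{i k_l(P)·r} G(k_l(P))` — the symbol, over the COARSE momentum `P`, of the
fine kernel with symbol `G` read on the coarse lattice `L•ℤ^{d+1} + r` (`latticeKernel_decimate`). -/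
def aliasSym (L : ℕ) (r : Fin (d + 1) → ℤ) (G : (Fin (d + 1) → ℂ) → ℂ) : (Fin (d + 1) → ℂ) → ℂ :=
  fun P => ((L : ℂ) ^ (d + 1))⁻¹ * ∑ l : Fin (d + 1) → Fin L, cphase r (aliasPt L l P) * G (aliasPt L l P)

/-- [folklore] The plane-wave symbol at a real momentum is the phase of `B4ContourShift`: `cphase r (ofRealVec q) = e^{i q·r}`. -/
theorem cphase_ofRealVec (r : Fin (d + 1) → ℤ) (q : Fin (d + 1) → ℝ) : cphase r (ofRealVec q) = cexp (I * phase q r) := rfl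

/-- [folklore] Updating one real coordinate shifts the phase: `phase (update p i v) x = phase p x + (v − p_i)·x_i`. -/
theorem phase_update (p : Fin (d + 1) → ℝ) (i : Fin (d + 1)) (v : ℝ) (x : Fin (d + 1) → ℤ) :
    phase (Function.update p i v) x = phase p x + ((v - p i : ℝ) : ℂ) * (x i : ℂ) := by
  unfold phase
  have h : ∀ μ, ((Function.update p i v μ : ℝ) : ℂ) * (x μ : ℂ) =
      (p μ : ℂ) * (x μ : ℂ) + (if μ = i then ((v - p i : ℝ) : ℂ) * (x i : ℂ) else 0) := by
    intro μ
    by_cases hμ : μ = i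
    · subst hμ; simp only [Function.update_self, if_true]; push_cast; ring
    · simp only [Function.update_of_ne hμ, hμ, if_false, add_zero]
  rw [Finset.sum_congr rfl (fun μ _ => h μ), Finset.sum_add_distrib, Finset.sum_ite_eq' Finset.univ i,
    if_pos (Finset.mem_univ i)]

/-- [folklore] The integrand `G(p) e^{ip·x}` is `2π`-periodic in each real coordinate when `G` is (`x ∈ ℤ^{d+1}`). -/
theorem integrand_periodic {G : (Fin (d + 1) → ℂ) → ℂ}
    (hper : ∀ (i : Fin (d + 1)) (P : Fin (d + 1) → ℂ), G (Function.update P i (P i + 2 * π)) = G P)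
    (x : Fin (d + 1) → ℤ) (i : Fin (d + 1)) (p : Fin (d + 1) → ℝ) :
    integrand G x (Function.update p i (p i + 2 * π)) = integrand G x p := by
  unfold integrand
  have e1 : ofRealVec (Function.update p i (p i + 2 * π)) = Function.update (ofRealVec p) i (ofRealVec p i + 2 * π) := by
    funext j
    by_cases hj : j = i
    · subst hj; simp only [ofRealVec, Function.update_self]; push_cast; ring
    · simp only [ofRealVec, Function.update_of_ne hj]
  have e2 : cexp (I * phase (Function.update p i (p i + 2 * π)) x) = cexp (I * phase p x) := by
    rw [phase_update, show ((p i + 2 * π - p i : ℝ) : ℂ) = 2 * π by push_cast; ring, mul_add, Complex.exp_add]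
    rw [show I * (2 * ↑π * (x i : ℂ)) = (x i : ℂ) * (2 * π * I) by ring, Complex.exp_int_mul_two_pi_mul_I, mul_one]
  rw [e1, hper, e2]

/-- [folklore] The integrand of a multiplier that is continuous on the real zone is continuous. -/
theorem continuous_integrand {G : (Fin (d + 1) → ℂ) → ℂ} (hcont : Continuous fun p : Fin (d + 1) → ℝ => G (ofRealVec p))
    (x : Fin (d + 1) → ℤ) : Continuous (integrand G x) := by
  unfold integrand phase
  refine hcont.mul (Continuous.cexp (continuous_const.mul ?_))
  exact continuous_finsetSum _ fun μ _ => (continuous_ofReal.comp (continuous_apply μ)).mul continuous_const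

/-- [folklore] The real alias momenta depend continuously on the coarse momentum. -/
theorem continuous_apt (l : Fin (d + 1) → Fin L) : Continuous (apt L l : (Fin (d + 1) → ℝ) → Fin (d + 1) → ℝ) :=
  continuous_pi fun i => ((continuous_apply i).add continuous_const).div_const _

/-- [folklore] **THE KEY PHASE IDENTITY**: at the alias momentum `k_l(p)` the phase against a point `L•z + r` of the coarse lattice
splits as `e^{i k_l(p)·(L•z + r)} = e^{i p·z} · e^{i k_l(p)·r}` — the term `e^{2πi l·z}` is `1`. -/
theorem cexp_phase_apt [NeZero L] (l : Fin (d + 1) → Fin L) (p : Fin (d + 1) → ℝ) (z r : Fin (d + 1) → ℤ) :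
    cexp (I * phase (apt L l p) ((L : ℤ) • z + r)) = cexp (I * phase p z) * cphase r (ofRealVec (apt L l p)) := by
  have hL : (L : ℂ) ≠ 0 := by exact_mod_cast NeZero.ne L
  set n : ℤ := ∑ i, ((l i : ℕ) : ℤ) * z i with hn
  have hsum : phase (apt L l p) ((L : ℤ) • z + r) = phase p z + (n : ℂ) * (2 * π) + phase (apt L l p) r := by
    unfold phase
    rw [hn]
    push_cast
    rw [Finset.sum_mul, ← Finset.sum_add_distrib, ← Finset.sum_add_distrib]
    refine Finset.sum_congr rfl fun i _ => ?_
    simp only [apt, Pi.add_apply, Pi.smul_apply, smul_eq_mul, Int.cast_add, Int.cast_mul, Int.cast_natCast]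
    push_cast
    field_simp
  rw [hsum, cphase_ofRealVec, mul_add, mul_add, Complex.exp_add, Complex.exp_add,
    show I * ((n : ℂ) * (2 * π)) = (n : ℂ) * (2 * π * I) by ring, Complex.exp_int_mul_two_pi_mul_I, mul_one]

/-- [folklore] POINTWISE: the integrand of the aliased symbol at `p` is the alias average of the original integrand at the alias momenta. -/
theorem integrand_aliasSym [NeZero L] (G : (Fin (d + 1) → ℂ) → ℂ) (r z : Fin (d + 1) → ℤ) (p : Fin (d + 1) → ℝ) :
    integrand (aliasSym L r G) z p =
      (((L : ℝ) ^ (d + 1))⁻¹ : ℝ) • ∑ l : Fin (d + 1) → Fin L, integrand G ((L : ℤ) • z + r) (apt L l p) := by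
  unfold integrand aliasSym
  rw [Complex.real_smul, Finset.mul_sum, Finset.sum_mul, Finset.mul_sum]
  push_cast
  refine Finset.sum_congr rfl fun l _ => ?_
  rw [aliasPt_ofRealVec, cexp_phase_apt]
  ring

/-- [folklore] The aliased symbol is continuous on the real zone when `G` is. -/
theorem continuous_aliasSym_ofRealVec {G : (Fin (d + 1) → ℂ) → ℂ} (hcont : Continuous fun p : Fin (d + 1) → ℝ => G (ofRealVec p))
    (r : Fin (d + 1) → ℤ) : Continuous fun p : Fin (d + 1) → ℝ => aliasSym L r G (ofRealVec p) := by
  unfold aliasSym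
  refine continuous_const.mul (continuous_finsetSum _ fun l _ => ?_)
  simp only [aliasPt_ofRealVec]
  refine Continuous.mul ?_ (hcont.comp (continuous_apt L l))
  simp only [cphase_ofRealVec]
  refine Continuous.cexp (continuous_const.mul ?_)
  unfold phase
  exact continuous_finsetSum _ fun μ _ =>
    (continuous_ofReal.comp ((continuous_apply μ).comp (continuous_apt L l))).mul continuous_const

/-- [folklore] **DECIMATION = ALIASING FOR THE FOURIER BOX INTEGRAL**: for `G` globally `2π`-periodic in each coordinate and continuous
on the real zone, `∫_{BZ} G(k) e^{ik·(L•z + r)} dk = ∫_{BZ} (aliasSym L r G)(p) e^{ip·z} dp`. -/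
theorem fourierBox_decimate [NeZero L] {G : (Fin (d + 1) → ℂ) → ℂ}
    (hper : ∀ (i : Fin (d + 1)) (P : Fin (d + 1) → ℂ), G (Function.update P i (P i + 2 * π)) = G P)
    (hcont : Continuous fun p : Fin (d + 1) → ℝ => G (ofRealVec p)) (z r : Fin (d + 1) → ℤ) :
    fourierBox G ((L : ℤ) • z + r) = fourierBox (aliasSym L r G) z := by
  unfold fourierBox
  rw [setIntegral_BZ_eq_sum_alias L (integrand G ((L : ℤ) • z + r)) (integrand_periodic hper _) (continuous_integrand hcont _)]
  have hint : ∀ l : Fin (d + 1) → Fin L, IntegrableOn (fun p => integrand G ((L : ℤ) • z + r) (apt L l p)) (BZ (d + 1)) :=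
    fun l => ((continuous_integrand hcont _).comp (continuous_apt L l)).continuousOn.integrableOn_compact (isCompact_BZ _)
  symm
  calc ∫ p in BZ (d + 1), integrand (aliasSym L r G) z p
      = ∫ p in BZ (d + 1), (((L : ℝ) ^ (d + 1))⁻¹ : ℝ) • ∑ l : Fin (d + 1) → Fin L, integrand G ((L : ℤ) • z + r) (apt L l p) :=
        integral_congr_ae (Filter.Eventually.of_forall fun p => integrand_aliasSym L G r z p)
    _ = (((L : ℝ) ^ (d + 1))⁻¹ : ℝ) • ∑ l : Fin (d + 1) → Fin L, ∫ p in BZ (d + 1), integrand G ((L : ℤ) • z + r) (apt L l p) := by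
        rw [integral_smul, integral_finsetSum _ fun l _ => hint l]

/-- [folklore] **DECIMATION = ALIASING FOR LATTICE KERNELS** (the theorem of this file): reading the lattice kernel of `G` on the coarse
lattice `L•ℤ^{d+1} + r` gives the lattice kernel, over the coarse lattice, of the aliased symbol:
`latticeKernel G (L•z + r) = latticeKernel (aliasSym L r G) z`. -/
theorem latticeKernel_decimate [NeZero L] {G : (Fin (d + 1) → ℂ) → ℂ}
    (hper : ∀ (i : Fin (d + 1)) (P : Fin (d + 1) → ℂ), G (Function.update P i (P i + 2 * π)) = G P)
    (hcont : Continuous fun p : Fin (d + 1) → ℝ => G (ofRealVec p)) (z r : Fin (d + 1) → ℤ) :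
    latticeKernel G ((L : ℤ) • z + r) = latticeKernel (aliasSym L r G) z := by
  unfold latticeKernel
  rw [fourierBox_decimate L hper hcont z r]

/-- [folklore] PURE DECIMATION (`r = 0`): `latticeKernel G (L•z) = latticeKernel (aliasSym L 0 G) z`, the aliased symbol being the plain
alias average `L^{−(d+1)} Σ_l G(k_l(P))` (`aliasSym_zero_apply`). -/
theorem latticeKernel_zsmul [NeZero L] {G : (Fin (d + 1) → ℂ) → ℂ}
    (hper : ∀ (i : Fin (d + 1)) (P : Fin (d + 1) → ℂ), G (Function.update P i (P i + 2 * π)) = G P)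
    (hcont : Continuous fun p : Fin (d + 1) → ℝ => G (ofRealVec p)) (z : Fin (d + 1) → ℤ) :
    latticeKernel G ((L : ℤ) • z) = latticeKernel (aliasSym L 0 G) z := by
  have h := latticeKernel_decimate L hper hcont z 0
  rwa [add_zero] at h

/-- [folklore] The aliased symbol at offset `0` is the plain alias average (the plane wave of the zero vector is `1`,
`CombesThomasFibreStep.cphase_zero_left`; re-derived inline to keep the imports Literature-only). -/
theorem aliasSym_zero_apply (G : (Fin (d + 1) → ℂ) → ℂ) (P : Fin (d + 1) → ℂ) :
    aliasSym L 0 G P = ((L : ℂ) ^ (d + 1))⁻¹ * ∑ l : Fin (d + 1) → Fin L, G (aliasPt L l P) := by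
  simp [aliasSym, cphase]

end Symbol

/-! ## §7 The aliased symbol is again globally periodic: blockings iterate -/

section Periodicity

variable (L : ℕ)

/-- [folklore] Natural iterates of the coordinate period for a function of COMPLEX momenta. -/
theorem periodic_update_nat {H : (Fin (d + 1) → ℂ) → ℂ}
    (hper : ∀ (i : Fin (d + 1)) (P : Fin (d + 1) → ℂ), H (Function.update P i (P i + 2 * π)) = H P)
    (i : Fin (d + 1)) (P : Fin (d + 1) → ℂ) (n : ℕ) : H (Function.update P i (P i + 2 * π * n)) = H P := by
  induction n generalizing P with
  | zero => simp
  | succ n ih =>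
      have e : Function.update P i (P i + 2 * π * ((n + 1 : ℕ) : ℂ)) =
          Function.update (Function.update P i (P i + 2 * π * (n : ℂ))) i
            ((Function.update P i (P i + 2 * π * (n : ℂ))) i + 2 * π) := by
        funext j
        by_cases hj : j = i
        · subst hj; simp only [Function.update_self]; push_cast; ring
        · simp only [Function.update_of_ne hj]
      rw [e, hper, ih]

/-- [folklore] The cyclic shift `l_i ↦ l_i + 1 (mod L)` of the `i`-th alias index, as a permutation of the alias index set. -/
def shiftIdx (L : ℕ) [NeZero L] (i : Fin (d + 1)) : (Fin (d + 1) → Fin L) ≃ (Fin (d + 1) → Fin L) where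
  toFun l := Function.update l i (l i + 1)
  invFun l := Function.update l i (l i - 1)
  left_inv l := by
    funext j
    by_cases hj : j = i
    · subst hj; simp
    · simp [hj]
  right_inv l := by
    funext j
    by_cases hj : j = i
    · subst hj; simp
    · simp [hj]

/-- [folklore] The carry of the cyclic shift: `l_i + 1 = ((l_i + 1) mod L) + L · ⌊(l_i + 1)/L⌋` read in `ℂ`. -/
theorem val_shift_cast [NeZero L] (i : Fin (d + 1)) (l : Fin (d + 1) → Fin L) :
    ((l i : ℕ) : ℂ) + 1 = ((shiftIdx L i l i : ℕ) : ℂ) + (L : ℂ) * ((((l i : ℕ) + 1) / L : ℕ) : ℂ) := by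
  have hv : ((shiftIdx L i l i : ℕ)) = ((l i : ℕ) + 1) % L := by
    show ((Function.update l i (l i + 1)) i : ℕ) = _
    rw [Function.update_self, Fin.val_add, Fin.val_one', Nat.add_mod_mod]
  have h := Nat.mod_add_div ((l i : ℕ) + 1) L
  rw [hv]
  exact_mod_cast h.symm

/-- [folklore] SHIFTING THE COARSE MOMENTUM BY ONE PERIOD PERMUTES THE ALIAS MOMENTA (up to whole periods in the shifted coordinate):
`k_l(P + 2π e_i) = k_{σ l}(P) + 2π q e_i`, `σ` the cyclic shift of `l_i`, `q = ⌊(l_i+1)/L⌋ ∈ {0, 1}`. -/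
theorem aliasPt_update [NeZero L] (i : Fin (d + 1)) (l : Fin (d + 1) → Fin L) (P : Fin (d + 1) → ℂ) :
    aliasPt L l (Function.update P i (P i + 2 * π)) =
      Function.update (aliasPt L (shiftIdx L i l) P) i
        (aliasPt L (shiftIdx L i l) P i + 2 * π * ((((l i : ℕ) + 1) / L : ℕ) : ℂ)) := by
  have hL : (L : ℂ) ≠ 0 := by exact_mod_cast NeZero.ne L
  funext j
  by_cases hj : j = i
  · subst hj
    simp only [aliasPt, Function.update_self]
    have h := val_shift_cast L j l
    field_simp
    linear_combination (2 * (π : ℂ)) * h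
  · simp only [aliasPt, Function.update_of_ne hj]
    show _ = (P j + 2 * ↑π * (((Function.update l i (l i + 1)) j : ℕ) : ℂ)) / ↑L
    rw [Function.update_of_ne hj]

/-- [folklore] **THE ALIASED SYMBOL IS GLOBALLY `2π`-PERIODIC IN EACH COORDINATE** whenever `G` is — so the output of one blocking is an
admissible input of the next (blockings ITERATE; with E8 `AliasNest` the alias indices nest). -/
theorem aliasSym_periodic [NeZero L] {G : (Fin (d + 1) → ℂ) → ℂ}
    (hper : ∀ (i : Fin (d + 1)) (P : Fin (d + 1) → ℂ), G (Function.update P i (P i + 2 * π)) = G P)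
    (r : Fin (d + 1) → ℤ) (i : Fin (d + 1)) (P : Fin (d + 1) → ℂ) :
    aliasSym L r G (Function.update P i (P i + 2 * π)) = aliasSym L r G P := by
  unfold aliasSym
  congr 1
  have hH : ∀ (j : Fin (d + 1)) (Q : Fin (d + 1) → ℂ),
      (fun Q => cphase r Q * G Q) (Function.update Q j (Q j + 2 * π)) = (fun Q => cphase r Q * G Q) Q := by
    intro j Q
    simp only [cphase_periodic, hper]
  calc ∑ l : Fin (d + 1) → Fin L, cphase r (aliasPt L l (Function.update P i (P i + 2 * π))) *
          G (aliasPt L l (Function.update P i (P i + 2 * π)))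
      = ∑ l : Fin (d + 1) → Fin L, cphase r (aliasPt L (shiftIdx L i l) P) * G (aliasPt L (shiftIdx L i l) P) := by
        refine Finset.sum_congr rfl fun l _ => ?_
        rw [aliasPt_update]
        exact periodic_update_nat (H := fun Q => cphase r Q * G Q) hH i (aliasPt L (shiftIdx L i l) P) _
    _ = ∑ l : Fin (d + 1) → Fin L, cphase r (aliasPt L l P) * G (aliasPt L l P) :=
        Equiv.sum_comp (shiftIdx L i) (fun l => cphase r (aliasPt L l P) * G (aliasPt L l P))

end Periodicity

/-! ## §8 From strip regularity: periodic strip-regular symbols are continuous on the real zone -/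

section StripReg

variable (L : ℕ) {G : (Fin (d + 1) → ℂ) → ℂ} {κ M : ℝ}

/-- [folklore] Global periodicity read on real momenta. -/
theorem periodic_ofRealVec (hper : ∀ (i : Fin (d + 1)) (P : Fin (d + 1) → ℂ), G (Function.update P i (P i + 2 * π)) = G P)
    (i : Fin (d + 1)) (p : Fin (d + 1) → ℝ) : G (ofRealVec (Function.update p i (p i + 2 * π))) = G (ofRealVec p) := by
  have e : ofRealVec (Function.update p i (p i + 2 * π)) = Function.update (ofRealVec p) i (ofRealVec p i + 2 * π) := by
    funext j
    by_cases hj : j = i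
    · subst hj; simp only [ofRealVec, Function.update_self]; push_cast; ring
    · simp only [ofRealVec, Function.update_of_ne hj]
  rw [e, hper]

/-- [folklore] THE DESCENT READ BACK EVERYWHERE: for a globally periodic `G`, pv17's torus function `descend G` at the class of `s` is
`G(2πs)` for EVERY real `s` (leaf-07-g9's records lemma, re-proved). -/
theorem descend_coe_of_periodic (hper : ∀ (i : Fin (d + 1)) (P : Fin (d + 1) → ℂ), G (Function.update P i (P i + 2 * π)) = G P)
    (s : Fin (d + 1) → ℝ) : descend G (fun i => ((s i : ℝ) : UnitAddCircle)) = G (ofRealVec fun i => 2 * π * s i) := by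
  choose k hk using fun i => rep_coe_eq_add_int (s i)
  unfold descend
  have e : (fun i => 2 * π * rep ((s i : ℝ) : UnitAddCircle)) = fun i => (2 * π * s i) + 2 * π * (k i : ℝ) := by
    funext i; rw [hk i]; ring
  rw [e]
  exact periodic_add_intVec (g := fun p => G (ofRealVec p)) (periodic_ofRealVec hper) _ k

/-- [folklore] **A PERIODIC STRIP-REGULAR SYMBOL IS CONTINUOUS AT EVERY REAL MOMENTUM** (`κ ≥ 0`): `p ↦ G(p)` on `ℝ^{d+1}` is the
continuous torus function `descend G` (`B4TorusKernel.continuous_descend`) composed with `p ↦ (p/2π mod 1)`. -/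
theorem continuous_ofRealVec_of_stripRegular (h : StripRegular G κ M) (hκ : 0 ≤ κ)
    (hper : ∀ (i : Fin (d + 1)) (P : Fin (d + 1) → ℂ), G (Function.update P i (P i + 2 * π)) = G P) :
    Continuous fun p : Fin (d + 1) → ℝ => G (ofRealVec p) := by
  have e : (fun p : Fin (d + 1) → ℝ => G (ofRealVec p)) =
      fun p => descend G (fun i => ((((2 * π)⁻¹ * p i : ℝ)) : UnitAddCircle)) := by
    funext p
    rw [descend_coe_of_periodic hper]
    congr 1; funext i; simp only [ofRealVec]; push_cast; field_simp
  rw [e]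
  refine (continuous_descend h hκ).comp (continuous_pi fun i => ?_)
  exact (AddCircle.continuous_mk' (1 : ℝ)).comp (continuous_const.mul (continuous_apply i))

/-- [folklore] **DECIMATION = ALIASING for a periodic strip-regular symbol** (the form road P1 ∕ E1 deliver their symbols in). -/
theorem latticeKernel_decimate_of_stripRegular [NeZero L] (h : StripRegular G κ M) (hκ : 0 ≤ κ)
    (hper : ∀ (i : Fin (d + 1)) (P : Fin (d + 1) → ℂ), G (Function.update P i (P i + 2 * π)) = G P)
    (z r : Fin (d + 1) → ℤ) : latticeKernel G ((L : ℤ) • z + r) = latticeKernel (aliasSym L r G) z :=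
  latticeKernel_decimate L hper (continuous_ofRealVec_of_stripRegular h hκ hper) z r

end StripReg

/-! ## §9 Offset sums: box ∕ contour sums of a fine kernel over a block are ONE coarse kernel -/

section OffsetSums

variable (L : ℕ)

/-- [folklore] The integrand of an aliased symbol is integrable on the zone (continuity). -/
theorem integrableOn_integrand_aliasSym {G : (Fin (d + 1) → ℂ) → ℂ} (hcont : Continuous fun p : Fin (d + 1) → ℝ => G (ofRealVec p))
    (r z : Fin (d + 1) → ℤ) : IntegrableOn (integrand (aliasSym L r G) z) (BZ (d + 1)) :=
  (continuous_integrand (continuous_aliasSym_ofRealVec L hcont r) z).continuousOn.integrableOn_compact (isCompact_BZ _)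

/-- [folklore] **OFFSET SUMS**: a finite weighted sum of readings of the fine kernel at the points `L•z + r_a` of ONE coarse block is the
coarse lattice kernel of the correspondingly weighted aliased symbols —
`Σ_{a ∈ R} w_a · latticeKernel G (L•z + r_a) = latticeKernel (P ↦ Σ_{a ∈ R} w_a · aliasSym L r_a G P) z`; with `R` = the straight-contour
points `r + s e_μ` of an `L`-block and `w = 1` this is the symbol of a pushed multiplier leg (`PushSumNest.pushSum_inr_inl_coarse`), the
weight `Σ_a e^{i k_l·r_a}` inside the alias average being road P1's contour weight. -/
theorem latticeKernel_sum_decimate [NeZero L] {ι : Type*} (R : Finset ι) (w : ι → ℂ) (r : ι → Fin (d + 1) → ℤ)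
    {G : (Fin (d + 1) → ℂ) → ℂ}
    (hper : ∀ (i : Fin (d + 1)) (P : Fin (d + 1) → ℂ), G (Function.update P i (P i + 2 * π)) = G P)
    (hcont : Continuous fun p : Fin (d + 1) → ℝ => G (ofRealVec p)) (z : Fin (d + 1) → ℤ) :
    ∑ a ∈ R, w a * latticeKernel G ((L : ℤ) • z + r a) = latticeKernel (fun P => ∑ a ∈ R, w a * aliasSym L (r a) G P) z := by
  rw [B4Green244.latticeKernel_sum_mul R w (fun a => aliasSym L (r a) G) z
    (fun a _ => integrableOn_integrand_aliasSym L hcont (r a) z)]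
  exact Finset.sum_congr rfl fun a _ => by rw [latticeKernel_decimate L hper hcont z (r a)]

end OffsetSums

end Summit.QuantumFields.BalabanUV.Beta.GAN24.AliasDecimate

end
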